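import Summits.ResolutionOfSingularities.ResolutionOfSingularities.Theorems.RadicialJungCleanModelsDimTwoFFiniteStep
import HarnessLib

/-!
# Loosely clean principalization at closed points in dimension 2 over an `F`-finite field,
# from Giraud 1983 (crux `CleanModels`, line `Sketch` rev 10)

Route `ResolutionOfSingularities/RadicialJung`, crux item `CleanModels`
(stmt-ResolutionOfSingularities-15917), line `Sketch` rev 10 (lead c2). The lead stub
`stub_principalizationDimTwoFFinite` CONDITIONALLY on Giraud's theorem (Giraud 1983, Thm. 2.4
with Prop. 1.5 (ii); the named fact `Giraud1983Thm24`, taken as the expanded hypothesis `hG`):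

* `mem_foldr_sup_iff` — membership in the union of a list of affine opens;
* `exists_model_over_list` — induction over a list of affine opens of the regular surface `W`
  (`exists_step` at each cons, the identity model at nil): a proper model, integral and regular
  of dimension `2`, an isomorphism off a closed set of closed points inside the union, loosely
  clean at every point over the union;
* `principalizationDimTwoFFinite_of_giraud` — for `W` regular integral separated of finite type
  over an `F`-finite field `k` of characteristic `p`, `dim W = 2`, and `g₀ ∈ K(W) ∖ K(W)^p`:
  a proper birational regular integral model on which at every (closed) point some non-trivial
  representative `Σ_{j<p} c_j^p g₀^j` is loosely clean — from a finite affine cover of the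
  quasi-compact `W`.
-/

noncomputable section

set_option linter.dupNamespace false -- mandated namespace of this single-conjunct summit

open CategoryTheory AlgebraicGeometry TopologicalSpace IsLocalRing
open Literature.AlgebraicGeometry.Resolution Literature.AlgebraicGeometry.Motives
open scoped TensorProduct

namespace Summit.ResolutionOfSingularities.ResolutionOfSingularities.Theorems.RadicialJung.CleanModels

universe u

/-- Membership in the union `((⊥ ⊔ U_n) ⊔ …) ⊔ U_1` of a list of affine opens. [folklore] -/
theorem mem_foldr_sup_iff {X : Scheme.{u}} (L : List X.affineOpens) (x : X) :
    x ∈ L.foldr (fun (U : X.affineOpens) (S : X.Opens) => S ⊔ U.1) ⊥ ↔ ∃ U ∈ L, x ∈ (U : X.Opens) := by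
  induction L with
  | nil => simp
  | cons U L ih =>
    rw [List.foldr_cons, Opens.mem_sup, ih]
    constructor
    · rintro (⟨U', hU', hx⟩ | hx)
      · exact ⟨U', List.mem_cons_of_mem _ hU', hx⟩
      · exact ⟨U, List.mem_cons_self, hx⟩
    · rintro ⟨U', hU', hx⟩
      rcases List.mem_cons.mp hU' with rfl | hU'
      · exact Or.inr hx
      · exact Or.inl ⟨U', hU', hx⟩

/-- `dim W = 2` from `dim W ≤ 2` and `¬ dim W ≤ 1`. [folklore] -/
theorem topologicalKrullDim_eq_two_of {X : Type*} [TopologicalSpace X]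
    (h₁ : ¬ topologicalKrullDim X ≤ 1) (h₂ : topologicalKrullDim X ≤ 2) :
    topologicalKrullDim X = 2 := by
  generalize hd : topologicalKrullDim X = d at h₁ h₂
  induction d using WithBot.recBotCoe with
  | bot => exact absurd bot_le h₁
  | coe n =>
    induction n using ENat.recTopCoe with
    | top =>
      exfalso
      have h3 : ((2 : ℕ∞) : WithBot ℕ∞) < ((⊤ : ℕ∞) : WithBot ℕ∞) :=
        WithBot.coe_lt_coe.mpr (ENat.coe_lt_top 2)
      exact absurd h₂ (not_le.mpr h3)
    | coe m =>
      have h2' : m ≤ 2 := by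
        have h := h₂
        rw [← WithBot.coe_ofNat, WithBot.coe_le_coe, ← Nat.cast_ofNat, Nat.cast_le] at h
        exact h
      have h1' : ¬ m ≤ 1 := by
        intro h
        apply h₁
        rw [← WithBot.coe_one, WithBot.coe_le_coe, ← Nat.cast_one, Nat.cast_le]
        exact h
      have hm : m = 2 := by omega
      subst hm
      rfl

section Main

variable (p : ℕ) [Fact p.Prime] (k : Type) [Field k] [CharP k p] (hk : IsFFinite p 1 k)
  (hG : ∀ (p : ℕ) [Fact p.Prime] (X : Scheme.{0}) [IsIntegral X] [CompactSpace X]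
    [CharP Γ(X, ⊤) p],
    Scheme.IsRegular X → topologicalKrullDim X = 2 →
    (∀ (x : X) [CharP (X.presheaf.stalk x) p],
      (frobenius (X.presheaf.stalk x) p).Finite ∧ (frobenius (X.presheaf.stalk x) p).Flat) →
    ∀ f : Γ(X, ⊤),
      (∀ c : X.functionField, c ^ p ≠ (X.presheaf.germ ⊤ (genericPoint X) trivial) f) →
    ∃ (X' : Scheme.{0}) (π : X' ⟶ X), IsProper π ∧ IsIntegral X' ∧ Scheme.IsRegular X' ∧
      (∃ U : X.Opens, ((U : Set X)ᶜ).Finite ∧ (∀ x ∈ (U : Set X)ᶜ, IsClosed ({x} : Set X)) ∧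
        IsIso (π ∣_ U)) ∧
      ∀ x' : X', ∃ (d r : ℕ) (hrd : r ≤ d) (t : Fin d → X'.presheaf.stalk x')
        (g u : X'.presheaf.stalk x') (a : Fin r → ℕ),
        Ideal.span (Set.range t) = maximalIdeal (X'.presheaf.stalk x') ∧
        ringKrullDim (X'.presheaf.stalk x') = (d : WithBot ℕ∞) ∧ (∀ i, 2 ≤ a i) ∧
        (X'.presheaf.germ ⊤ x' trivial) (π.appTop f) =
          g ^ p + u * ∏ i : Fin r, t (Fin.castLE hrd i) ^ a i ∧
        (((∃ i, ¬ p ∣ a i) ∧ IsUnit u) ∨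
          LinearIndependent (ResidueField (X'.presheaf.stalk x'))
            (fun i => ((1 : ResidueField (X'.presheaf.stalk x')) ⊗ₜ[X'.presheaf.stalk x']
              (KaehlerDifferential.D ℤ (X'.presheaf.stalk x')
                ((Fin.snoc (fun i : Fin r => t (Fin.castLE hrd i)) u :
                  Fin (r + 1) → X'.presheaf.stalk x') i)) :
              ResidueField (X'.presheaf.stalk x') ⊗[X'.presheaf.stalk x']
                (Ω[X'.presheaf.stalk x'⁄ℤ])))))
  (W : Scheme.{0}) [IsIntegral W] (f : W ⟶ Spec (.of k)) [LocallyOfFiniteType f]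
  (hW : Scheme.IsRegular W) (hdimW : topologicalKrullDim W = 2) (g₀ : W.functionField)
  (hg₀ : ∀ c : W.functionField, c ^ p ≠ g₀)

include f hk hG hW hdimW hg₀ in
/-- **The induction over a list of affine opens.** See the module docstring. -/
theorem exists_model_over_list (L : List W.affineOpens) :
    ∃ (V : Scheme.{0}) (π : V ⟶ W) (_ : IsIntegral V) (_ : IsDominant π) (_ : IsProper π)
      (M : Set W) (hM : IsClosed M),
      Scheme.IsRegular V ∧ topologicalKrullDim V = 2 ∧ (∀ x ∈ M, IsClosed ({x} : Set W)) ∧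
      M ⊆ ((L.foldr (fun (U : W.affineOpens) (S : W.Opens) => S ⊔ U.1) ⊥ : W.Opens) : Set W) ∧
      IsIso (π ∣_ ⟨Mᶜ, hM.isOpen_compl⟩) ∧
      ∀ v : V, π.base v ∈ (L.foldr (fun (U : W.affineOpens) (S : W.Opens) => S ⊔ U.1) ⊥ : W.Opens) →
        ∃ c : Fin p → W.functionField, (∃ j : Fin p, (j : ℕ) ≠ 0 ∧ c j ≠ 0) ∧
        ((∃ (d m : ℕ) (hmd : m ≤ d) (t : Fin d → V.presheaf.stalk v) (a : Fin m → ℕ)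
            (u : V.presheaf.stalk v), IsUnit u ∧
            Ideal.span (Set.range t) = maximalIdeal (V.presheaf.stalk v) ∧
            ringKrullDim (V.presheaf.stalk v) = (d : WithBot ℕ∞) ∧ 0 < m ∧ (∀ i, ¬ p ∣ a i) ∧
            RatFn.functionFieldMap π (∑ j : Fin p, c j ^ p * g₀ ^ (j : ℕ)) =
              algebraMap (V.presheaf.stalk v) V.functionField
                (u * ∏ i : Fin m, t (Fin.castLE hmd i) ^ (a i))) ∨
          (∃ u : V.presheaf.stalk v, IsUnit u ∧
            RatFn.functionFieldMap π (∑ j : Fin p, c j ^ p * g₀ ^ (j : ℕ)) =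
              algebraMap (V.presheaf.stalk v) V.functionField u ∧
            ∀ c' : V.presheaf.stalk v, u - c' ^ p ∉ maximalIdeal (V.presheaf.stalk v)) ∨
          (∃ s c' : V.presheaf.stalk v,
            RatFn.functionFieldMap π (∑ j : Fin p, c j ^ p * g₀ ^ (j : ℕ)) =
              algebraMap (V.presheaf.stalk v) V.functionField s ∧
            s - c' ^ p ∈ maximalIdeal (V.presheaf.stalk v) ∧
            s - c' ^ p ∉ maximalIdeal (V.presheaf.stalk v) ^ 2)) := by
  induction L with
  | nil =>
    haveI : IsIso (𝟙 W ∣_ (⟨(∅ : Set W)ᶜ, isClosed_empty.isOpen_compl⟩ : W.Opens)) := inferInstance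
    refine ⟨W, 𝟙 W, inferInstance, inferInstance, inferInstance, ∅, isClosed_empty, hW, hdimW,
      fun x hx => hx.elim, Set.empty_subset _, this, fun v hv => ?_⟩
    simp at hv
  | cons U L ih =>
    obtain ⟨V, π, hVint, hπdom, hπprop, M, hM, hVreg, hdimV, hMcl, hMS, hMiso, hclean⟩ := ih
    haveI := hVint; haveI := hπdom; haveI := hπprop; haveI := hMiso
    obtain ⟨V', π', hV'int, hπ'dom, hπ'prop, M', hM', hV'reg, hdimV', hM'cl, hM'S, hM'iso,
      hclean'⟩ := exists_step p k hk hG W f hdimW g₀ hg₀ V π hVreg hdimV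
        (L.foldr (fun (U : W.affineOpens) (S : W.Opens) => S ⊔ U.1) ⊥) M hM hMcl hMS hclean U U.2
    exact ⟨V', π', hV'int, hπ'dom, hπ'prop, M', hM', hV'reg, hdimV', hM'cl, hM'S, hM'iso, hclean'⟩

include hk hG hW hdimW hg₀ in
/-- **Loosely clean principalization at closed points, dimension 2, `F`-finite ground field —
conditionally on Giraud's theorem** (`hG` = the named fact `Giraud1983Thm24`, expanded). For `W`
regular integral quasi-compact of finite type over an `F`-finite field `k` of characteristic `p`
with `dim W = 2` and `g₀ ∈ K(W) ∖ K(W)^p`, there is a proper birational `π : V → W`, `V`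
integral and regular, such that at every closed `v ∈ V` some non-trivial representative
`Σ_{j<p} c_j^p g₀^j` pulls back to a loosely clean element of `𝒪_{V,v}`. -/
theorem principalizationDimTwoFFinite_of_giraud [QuasiCompact f] :
    ∃ (V : Scheme.{0}) (π : V ⟶ W) (_ : IsIntegral V) (_ : IsDominant π),
      IsProper π ∧ IsBirational π ∧ Scheme.IsRegular V ∧
      ∀ v : V, IsClosed ({v} : Set V) →
        ∃ c : Fin p → W.functionField, (∃ j : Fin p, (j : ℕ) ≠ 0 ∧ c j ≠ 0) ∧
        ((∃ (d m : ℕ) (hmd : m ≤ d) (t : Fin d → V.presheaf.stalk v) (a : Fin m → ℕ)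
            (u : V.presheaf.stalk v), IsUnit u ∧
            Ideal.span (Set.range t) = maximalIdeal (V.presheaf.stalk v) ∧
            ringKrullDim (V.presheaf.stalk v) = (d : WithBot ℕ∞) ∧ 0 < m ∧ (∀ i, ¬ p ∣ a i) ∧
            RatFn.functionFieldMap π (∑ j : Fin p, c j ^ p * g₀ ^ (j : ℕ)) =
              algebraMap (V.presheaf.stalk v) V.functionField
                (u * ∏ i : Fin m, t (Fin.castLE hmd i) ^ (a i))) ∨
          (∃ u : V.presheaf.stalk v, IsUnit u ∧
            RatFn.functionFieldMap π (∑ j : Fin p, c j ^ p * g₀ ^ (j : ℕ)) =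
              algebraMap (V.presheaf.stalk v) V.functionField u ∧
            ∀ c' : V.presheaf.stalk v, u - c' ^ p ∉ maximalIdeal (V.presheaf.stalk v)) ∨
          (∃ s c' : V.presheaf.stalk v,
            RatFn.functionFieldMap π (∑ j : Fin p, c j ^ p * g₀ ^ (j : ℕ)) =
              algebraMap (V.presheaf.stalk v) V.functionField s ∧
            s - c' ^ p ∈ maximalIdeal (V.presheaf.stalk v) ∧
            s - c' ^ p ∉ maximalIdeal (V.presheaf.stalk v) ^ 2)) := by
  classical
  haveI : CompactSpace W := QuasiCompact.compactSpace_of_compactSpace f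
  -- a finite affine cover
  obtain ⟨t, ht⟩ := isCompact_univ.elim_finite_subcover (fun U : W.affineOpens => (U : Set W))
    (fun U => U.1.2) (fun x _ => by
      obtain ⟨_, ⟨U, hU, rfl⟩, hxU, -⟩ := W.isBasis_affineOpens.exists_subset_of_mem_open
        (Set.mem_univ x) isOpen_univ
      exact Set.mem_iUnion.mpr ⟨⟨U, hU⟩, hxU⟩)
  set L : List W.affineOpens := t.toList
  have hcov : ∀ x : W, x ∈ (L.foldr (fun (U : W.affineOpens) (S : W.Opens) => S ⊔ U.1) ⊥ : W.Opens) := by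
    intro x
    obtain ⟨U, hU⟩ := Set.mem_iUnion.mp (ht (Set.mem_univ x))
    obtain ⟨hUt, hxU⟩ := Set.mem_iUnion.mp hU
    exact (mem_foldr_sup_iff L x).mpr ⟨U, Finset.mem_toList.mpr hUt, hxU⟩
  obtain ⟨V, π, hVint, hπdom, hπprop, M, hM, hVreg, -, hMcl, -, hMiso, hclean⟩ :=
    exists_model_over_list p k hk hG W f hW hdimW g₀ hg₀ L
  haveI := hVint; haveI := hπdom; haveI := hπprop; haveI := hMiso
  have hηW : ¬ IsClosed ({genericPoint W} : Set W) :=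
    not_isClosed_singleton_genericPoint (by rw [hdimW]; decide)
  have hMdense : Dense ((⟨Mᶜ, hM.isOpen_compl⟩ : W.Opens) : Set W) :=
    dense_compl_of_forall_isClosed hM hMcl hηW
  have hMdense' : Dense ((π ⁻¹ᵁ (⟨Mᶜ, hM.isOpen_compl⟩ : W.Opens) : V.Opens) : Set V) := by
    refine (π ⁻¹ᵁ (⟨Mᶜ, hM.isOpen_compl⟩ : W.Opens)).2.dense ?_
    obtain ⟨x, hx⟩ := exists_preimage_of_isIso_morphismRestrict π ⟨Mᶜ, hM.isOpen_compl⟩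
      (y := genericPoint W) (fun hη => hηW (hMcl _ hη))
    exact ⟨x, show π.base x ∈ Mᶜ by rw [hx]; exact fun hη => hηW (hMcl _ hη)⟩
  exact ⟨V, π, hVint, hπdom, hπprop, ⟨_, hMdense, hMdense', hMiso⟩, hVreg,
    fun v _ => hclean v (hcov _)⟩

end Main

end Summit.ResolutionOfSingularities.ResolutionOfSingularities.Theorems.RadicialJung.CleanModels

end
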